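import Summits.HodgeConjecture.HodgeConjecture.Theorems.OpenQuestionsKummerModuliSpaces
import Summits.HodgeConjecture.HodgeConjecture.Theorems.OpenQuestionsFloccariVaresco
import HarnessLib
import HarnessLib.Audit

/-!
# OpenQuestionsKummerModuliSpacesGlue — kernel links between the typed open question "Kummer moduli spaces of sheaves are motivated by the abelian surface" and the tree's typed statements (nothing asserted)

HONEST FRAMING: kernel glue only; every theorem below takes the conjectures of
`Theorems/OpenQuestionsKummerModuliSpaces.lean` ∕ `Theorems/OpenQuestionsFloccariVaresco.lean` (or a named
Literature fact) as HYPOTHESES.  Nothing here asserts `HodgeConjecture`, `HC_AV`, `W₆`, `HC_Kum4Type`,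
`HC_KummerType` or any conjecture.  Seat `hodge-lit-oqh-2` gen 6 (D-0088(4) LT-H4).  What is linked:
* Arapura's named fact `HodgeTheory.Arapura2006_hodgeClasses_algebraic_of_isDominatedByPowers` ∧
  `KummerSheafModuliSpace_dominatedByAbelianSurface` ⟹ `HC_KummerSheafModuliSpace` — through the Literature
  kernel `ModuliOfSheaves.IsKummerSheafModuliSpace.hodgeConjectureFor_of_isDominatedByPowers` (which feeds
  Arapura with the tree's THEOREM `HodgeTheory.hodgeConjectureFor_powSucc_of_surface`: the Hodge conjecture
  for every power of every abelian surface);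
* `HC_KummerTypePowers` (Floccari–Varesco leaf) ⟹ `HC_KummerSheafModuliSpace` (every Kummer moduli space
  `K_H(v)` is a smooth projective `Kumⁿ`-type variety by the clauses of `IsKummerSheafModuliSpace`; the
  single variety is the power `K¹ ≅ K`, `hodgeConjectureFor_pow_one_iff`).
-/

noncomputable section

open Literature.AlgebraicGeometry Literature.AlgebraicGeometry.Motives
  Literature.AlgebraicGeometry.HodgeTheory Literature.AlgebraicGeometry.ModuliOfSheaves

-- `Summit.<Summit>.<Problem>` is the mandated summit-side namespace (CONVENTIONS §2); for the
-- single-conjunct summit `HodgeConjecture` the two coincide, so the duplicate is deliberate.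
set_option linter.dupNamespace false

namespace Summit.HodgeConjecture.HodgeConjecture.Theorems

/-- **KERNEL: Arapura 2006 Lemma 4.2 (named fact) and domination of every Kummer moduli space `K_H(v)` by
the powers of its abelian surface imply the Hodge conjecture for every `K_H(v)` of `Kumⁿ`-type, `n ≥ 2`,
AND for all its powers** (the Hodge conjecture for all powers of abelian surfaces is a theorem of the tree;
Literature kernel `IsKummerSheafModuliSpace.hodgeConjectureFor_of_isDominatedByPowers`).
[cite: Arapura2006, Lemma 4.2 and Lemma 1.1 (§§1, 4)] [cite: Floccari2023OG6Motive, §1 (the expectation and its intended consequence)] -/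
theorem hc_kummerSheafModuliSpace_of_dominated
    (hA : Arapura2006_hodgeClasses_algebraic_of_isDominatedByPowers)
    (hD : KummerSheafModuliSpace_dominatedByAbelianSurface) : HC_KummerSheafModuliSpace :=
  fun n hn A _ hK ↦ hK.hodgeConjectureFor_of_isDominatedByPowers hA (hD n hn A hK)

/-- **KERNEL: the Hodge conjecture for all powers of every projective `Kumⁿ`-variety (`HC_KummerTypePowers`)
implies it for every Kummer moduli space `K_H(v)` and its powers** (the first power `K¹ = Spec ℂ × K ≅ K`
transported by `hodgeConjectureFor_pow_one_iff`). [cite: Yoshioka2001AbelianSurfaces, Thm. 0.2 (1) (K_H(v) is of Kummer type)]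
[cite: FloccariVaresco2024, Rem. 2.2 (§2)] -/
theorem hc_kummerSheafModuliSpace_of_hc_kummerTypePowers (h : HC_KummerTypePowers) :
    HC_KummerSheafModuliSpace := by
  intro n hn A K hK
  refine ⟨?_, fun m ↦ h n hn hK.isSmoothProjective hK.isOfGeneralizedKummerType m⟩
  have h1 : HodgeConjectureFor ((0 + 1) * (2 * n)) (K.pow (0 + 1)) :=
    h n hn hK.isSmoothProjective hK.isOfGeneralizedKummerType 0
  rw [zero_add, one_mul] at h1
  exact (hodgeConjectureFor_pow_one_iff K).1 h1

end Summit.HodgeConjecture.HodgeConjecture.Theorems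

end
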